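import Summits.AtomisticToContinuum.HydrodynamicLimit.Theses.OneFlightGossipEngine
import Summits.AtomisticToContinuum.HydrodynamicLimit.Theorems.OneFlightGossipEngineKineticCurrentsWindowLDUniformOneBodyLedgerPrelimB
import Mathlib.Probability.Kernel.Disintegration.Integral
import Mathlib.Probability.Kernel.RadonNikodym
import Literature.MathematicalPhysics.KineticTheory.HardSphereEulerProofs
import Literature.MathematicalPhysics.KineticTheory.VelocityBlindPlacement
import HarnessLib

/-!
# The one-body entropy ledger from static domination
# (registered stub `stub_oneBodyLedger_of_static` of line `local-gibbs-entropy-ledger`,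
# crux `KineticCurrentsWindowLDUniform`, stmt-AtomisticToContinuum-14662)

**Result (S2).** Assume static hydrodynamic domination (S1): for continuous `θ₀ > 0`, `u₀` on `𝕋³` and a
continuous `F` on `𝕋³ × ℝ³` with `|F(x,v)| ≤ C(1 + ‖v‖²)`, `F ⊥ 1, vⱼ, ‖v‖²` under the local
Maxwellians, `|∫ F(x,v) M_{1,θ,u}(v) dv| ≤ K_S1 · E_x(u,θ)` with
`E_x(u,θ) = ‖u - u₀(x)‖²/(2θ₀(x)) + (3/2)(θ/θ₀(x) - 1 - log(θ/θ₀(x)))`. Then for the same data there are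
`K, L > 0` such that for EVERY probability law `f` on `𝕋³ × ℝ³`, in `ℝ≥0∞`,
`ofReal |∫ F df| ≤ K ∫ KL(f(·|x) ‖ N(u₀(x), θ₀(x) id)) f.fst(dx) + L ∫ (inf_{u,θ>0} KL(f(·|x) ‖ N(u, θ id)))^{1/2} f.fst(dx)`,
with fibres `f(·|x) = f.condKernel x`.

**Proof.** Per fibre `μ = f(·|x)` (`obl_fibre`): if `KL(μ ‖ N(u,θ)) = ∞` for all Maxwellians both sides
are `⊤`. Otherwise (Prelim A) `μ` has a mean `m`, a temperature `e > 0`, `∫‖v‖²dμ = 3e + ‖m‖²`, and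
Gaussian Pythagoras `KL(μ ‖ N(u',θ')) = KL(μ ‖ N(m,e)) + E(m,e;u',θ')` shows that the infimum over
Maxwellians is `H = KL(μ ‖ N(m,e))` and that `KL(μ ‖ M_x) = H + E_x(m,e)`. HOT fibres
(`3e + ‖m‖² > Θ = 4U² + 12θ_M + 1`, `U = max ‖u₀‖`, `θ_m ≤ θ₀ ≤ θ_M` by compactness of `𝕋³`) are paid
linearly: `|∫ F(x,·) dμ| ≤ C(1 + 3e + ‖m‖²) ≤ 16 C θ_M E_x(m,e)` (`obl_hot`, from `log s ≤ s/2`). COLD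
fibres: `∫ F(x,·) dμ = ∫ F(x,·) dN(m,e) + (∫ F(x,·) dμ - ∫ F(x,·) dN(m,e))`, the first term is
`≤ K_S1 E_x(m,e)` by S1 at `(u,θ) = (m,e)`, the second `≤ L √H` by the Donsker–Varadhan kinetic bound
of Prelim B. Assembly: `f = f.fst ⊗ f.condKernel` (`Measure.integral_condKernel`; `∫ F df = 0` if
`F ∉ L¹(f)`), `‖∫ φ‖ₑ ≤ ∫⁻ ‖φ‖ₑ`, the fibrewise bound, and measurability of
`x ↦ KL(f.condKernel x ‖ M_x)` (`obl_measurable_klDiv`: `{κ a ≪ η a}` is measurable and the kernel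
density `Kernel.rnDeriv` is jointly measurable) to split the outer integral.
-/

noncomputable section

open MeasureTheory Set Filter InformationTheory ProbabilityTheory
open scoped ENNReal Topology

namespace Summit.AtomisticToContinuum.HydrodynamicLimit.Theorems.KineticCurrentsWindowLDUniformLocalGibbs

open Literature.Analysis.FluidPDE (HardSphereFlow Config localMaxwellian canonicalDensity liouville)
open Literature.MathematicalPhysics.KineticTheory (T3 V3 hsDiameter localGibbsLaw localGibbsMeasure
  localGibbsProfile gaussMeasure integral_localMaxwellian_smul integral_gaussMeasure)
open Summit.AtomisticToContinuum.HydrodynamicLimit.Theses.OneFlightGossipEngine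
  (KineticCurrentsWindowLDUniform)
open Literature.MathematicalPhysics.KineticTheory.VelocityBlindPlacement (Flow)

/-! ### Measurability of the fibre entropy -/

/-- **The relative entropy between two finite kernels is measurable in the parameter** (countably
generated target): `a ↦ KL(κ a ‖ η a)` is `⊤` off the measurable set `{κ a ≪ η a}` and the
`η a`-integral of `klFun` of the jointly measurable kernel density `∂κ/∂η` on it. [folklore] -/
theorem obl_measurable_klDiv {α γ : Type*} [MeasurableSpace α] [MeasurableSpace γ]
    [MeasurableSpace.CountableOrCountablyGenerated α γ] (κ η : Kernel α γ) [IsFiniteKernel κ]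
    [IsFiniteKernel η] : Measurable fun a => klDiv (κ a) (η a) := by
  classical
  have h : (fun a => klDiv (κ a) (η a)) = fun a => if κ a ≪ η a then
      ∫⁻ x, ENNReal.ofReal (klFun (Kernel.rnDeriv κ η a x).toReal) ∂(η a) else ∞ := by
    funext a
    rw [klDiv_eq_lintegral_klFun]
    split_ifs with hac
    · refine lintegral_congr_ae ?_
      filter_upwards [Kernel.rnDeriv_eq_rnDeriv_measure (κ := κ) (η := η) (a := a)] with x hx
      rw [hx]
    · rfl
  rw [h]
  refine Measurable.ite (Kernel.measurableSet_absolutelyContinuous κ η) ?_ measurable_const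
  exact (measurable_klFun.comp (Kernel.measurable_rnDeriv κ η).ennreal_toReal).ennreal_ofReal
    |>.lintegral_kernel_prod_right

/-- The Maxwellian reference field `x ↦ N(u₀(x), θ₀(x) id)` is a measurable family of measures for
measurable profiles. [folklore] -/
theorem obl_measurable_gaussMeasure {θ₀ : T3 → ℝ} {u₀ : T3 → V3} (hθ : Measurable θ₀)
    (hu : Measurable u₀) : Measurable fun x : T3 => gaussMeasure (u₀ x) (θ₀ x) := by
  refine Measure.measurable_of_measurable_coe _ fun s hs => ?_
  have hφ : Measurable fun p : T3 × V3 => u₀ p.1 + Real.sqrt (θ₀ p.1) • p.2 := by fun_prop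
  have h : (fun x : T3 => gaussMeasure (u₀ x) (θ₀ x) s) = fun x =>
      stdGaussian V3 (Prod.mk x ⁻¹' ((fun p : T3 × V3 => u₀ p.1 + Real.sqrt (θ₀ p.1) • p.2) ⁻¹' s)) := by
    funext x
    rw [gaussMeasure, Measure.map_apply (by fun_prop) hs]
    rfl
  rw [h]
  exact measurable_measure_prodMk_left (hφ hs)

/-- Measurability of the fibre entropy against the Maxwellian reference field, for any finite
kernel of fibres (e.g. `f.condKernel`). [folklore] -/
theorem obl_measurable_klDiv_gauss {θ₀ : T3 → ℝ} {u₀ : T3 → V3} (hθ : Measurable θ₀)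
    (hu : Measurable u₀) (κ : Kernel T3 V3) [IsFiniteKernel κ] :
    Measurable fun x => klDiv (κ x) (gaussMeasure (u₀ x) (θ₀ x)) := by
  let η : Kernel T3 V3 := ⟨fun x => gaussMeasure (u₀ x) (θ₀ x), obl_measurable_gaussMeasure hθ hu⟩
  haveI : IsMarkovKernel η :=
    ⟨fun x => show IsProbabilityMeasure (gaussMeasure (u₀ x) (θ₀ x)) from inferInstance⟩
  exact obl_measurable_klDiv κ η

/-! ### The fibrewise ledger -/

/-- **Hot fibres are paid linearly by the hydrodynamic entropy.** With `θ_m ≤ θ₀ ≤ θ_M`,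
`‖u₀‖ ≤ U` and `Θ = 4U² + 12θ_M + 1`: if `3e + ‖m‖² > Θ` then
`C(1 + 3e + ‖m‖²) ≤ 16 C θ_M · (‖m-u₀‖²/(2θ₀) + (3/2)(e/θ₀ - 1 - log(e/θ₀)))`
(from `log s ≤ s/2` and `‖m‖² ≤ 2‖m-u₀‖² + 2U²`). [folklore] -/
theorem obl_hot {C θm θM U Θ θ₀ e : ℝ} {m u₀ : V3} (hC : 0 ≤ C) (hθm : 0 < θm) (hθ₀m : θm ≤ θ₀)
    (hθ₀M : θ₀ ≤ θM) (hu₀ : ‖u₀‖ ≤ U) (hΘ : Θ = 4 * U ^ 2 + 12 * θM + 1) (he : 0 < e)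
    (hS : Θ < 3 * e + ‖m‖ ^ 2) :
    C * (1 + (3 * e + ‖m‖ ^ 2)) ≤
      16 * C * θM * (‖m - u₀‖ ^ 2 / (2 * θ₀) + 3 / 2 * (e / θ₀ - 1 - Real.log (e / θ₀))) := by
  have hθ₀ : 0 < θ₀ := hθm.trans_le hθ₀m
  have hθM : 0 < θM := hθ₀.trans_le hθ₀M
  obtain ⟨E, hE⟩ : ∃ E : ℝ,
      E = ‖m - u₀‖ ^ 2 / (2 * θ₀) + 3 / 2 * (e / θ₀ - 1 - Real.log (e / θ₀)) := ⟨_, rfl⟩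
  rw [← hE]
  have hlog : Real.log (e / θ₀) ≤ e / θ₀ / 2 := by
    -- `log t ≤ t/2`: `log (t/2) ≤ t/2 - 1` and `log 2 ≤ 1`
    have ht : 0 < e / θ₀ := div_pos he hθ₀
    have h1 := Real.log_le_sub_one_of_pos (half_pos ht)
    have h2 : Real.log 2 ≤ 1 := by linarith [Real.log_le_sub_one_of_pos (two_pos : (0 : ℝ) < 2)]
    rw [Real.log_div ht.ne' two_ne_zero] at h1
    linarith
  have hp : ‖m - u₀‖ ^ 2 / (2 * θM) ≤ ‖m - u₀‖ ^ 2 / (2 * θ₀) :=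
    div_le_div_of_nonneg_left (sq_nonneg _) (by positivity) (by linarith)
  have heq : e / θM ≤ e / θ₀ := div_le_div_of_nonneg_left he.le hθ₀ hθ₀M
  have hm1 : ‖m‖ ≤ ‖m - u₀‖ + ‖u₀‖ := norm_le_norm_sub_add m u₀
  have hm2 : ‖m‖ ^ 2 ≤ 2 * ‖m - u₀‖ ^ 2 + 2 * U ^ 2 := by
    nlinarith [norm_nonneg (m - u₀), norm_nonneg u₀, norm_nonneg m, sq_nonneg (‖m - u₀‖ - ‖u₀‖)]
  have hElow : ‖m - u₀‖ ^ 2 / (2 * θM) + 3 / 4 * (e / θM) - 3 / 2 ≤ E := by rw [hE]; linarith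
  have f1 : θM * (‖m - u₀‖ ^ 2 / (2 * θM)) = ‖m - u₀‖ ^ 2 / 2 := by field_simp
  have f2 : θM * (e / θM) = e := by field_simp
  have h8 : 3 * e + ‖m‖ ^ 2 ≤ 8 * θM * E := by
    nlinarith [mul_le_mul_of_nonneg_left hElow hθM.le, f1, f2, hm2, sq_nonneg U]
  have h1S : 1 ≤ 3 * e + ‖m‖ ^ 2 := by nlinarith [sq_nonneg U]
  calc C * (1 + (3 * e + ‖m‖ ^ 2)) ≤ C * (2 * (8 * θM * E)) :=
        mul_le_mul_of_nonneg_left (by linarith) hC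
    _ = 16 * C * θM * E := by ring

/-- `∫ g M_{1,θ,u} dv = ∫ g dN(u,θ)` (`θ > 0`). [folklore] -/
theorem obl_integral_mul_localMaxwellian (g : V3 → ℝ) (u : V3) {θ : ℝ} (hθ : 0 < θ) :
    ∫ v, g v * localMaxwellian 1 θ u v = ∫ v, g v ∂gaussMeasure u θ := by
  rw [integral_gaussMeasure u hθ, ← integral_localMaxwellian_smul hθ u g]
  congr 1
  funext v
  rw [smul_eq_mul, mul_comm]

/-- **The fibrewise ledger.** For one position `x` and one probability law `μ` of the velocity:
`ofReal |∫ F(x,·) dμ| ≤ K · KL(μ ‖ M_x) + L₁ · (inf_{u,θ>0} KL(μ ‖ N(u,θ)))^{1/2}` with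
`K = K₁ + 16 C θ_M + 1`, given the static domination constant `K₁` (S1) and the kinetic
constant `L₁` at the coldness threshold `Θ = 4U² + 12θ_M + 1`. If every Gaussian entropy of
`μ` is infinite both sides are `⊤`; otherwise Gaussian Pythagoras at the moment-matched
Maxwellian `N(m,e)` splits `KL(μ‖M_x) = KL(μ‖N(m,e)) + E_x(m,e)` and identifies the infimum;
hot fibres (`3e + ‖m‖² > Θ`) are paid by `E_x`, cold ones by S1 at `(m,e)` plus the kinetic
bound. [folklore] -/
theorem obl_fibre {θ₀ : T3 → ℝ} {u₀ : T3 → V3} {F : T3 × V3 → ℝ} {C K₁ L₁ θm θM U Θ : ℝ}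
    (hF : Continuous F) (hFC : ∀ y, |F y| ≤ C * (1 + ‖y.2‖ ^ 2)) (hC : 0 ≤ C) (hθm : 0 < θm)
    (hθ₀ : ∀ x, θm ≤ θ₀ x ∧ θ₀ x ≤ θM) (hu₀ : ∀ x, ‖u₀ x‖ ≤ U)
    (hΘ : Θ = 4 * U ^ 2 + 12 * θM + 1) (hK₁ : 0 ≤ K₁) (hL₁ : 0 ≤ L₁)
    (hdom : ∀ (x : T3) (u : V3) (θ : ℝ), 0 < θ → |∫ v, F (x, v) * localMaxwellian 1 θ u v| ≤
      K₁ * (‖u - u₀ x‖ ^ 2 / (2 * θ₀ x) + 3 / 2 * (θ / θ₀ x - 1 - Real.log (θ / θ₀ x))))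
    (hkin : ∀ (g : V3 → ℝ), Continuous g → (∀ v, |g v| ≤ C * (1 + ‖v‖ ^ 2)) →
      ∀ (u : V3) (θ : ℝ), 0 < θ → θ ≤ Θ → ‖u‖ ^ 2 ≤ Θ →
      ∀ (μ : Measure V3) [IsProbabilityMeasure μ], Integrable (fun v : V3 => ‖v‖ ^ 2) μ →
        ∫ v, ‖v‖ ^ 2 ∂μ ≤ Θ → klDiv μ (gaussMeasure u θ) ≠ ⊤ →
        |∫ v, g v ∂μ - ∫ v, g v ∂gaussMeasure u θ| ≤
          L₁ * Real.sqrt (klDiv μ (gaussMeasure u θ)).toReal)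
    (x : T3) (μ : Measure V3) [IsProbabilityMeasure μ] :
    ENNReal.ofReal |∫ v, F (x, v) ∂μ| ≤
      ENNReal.ofReal (K₁ + 16 * C * θM + 1) * klDiv μ (gaussMeasure (u₀ x) (θ₀ x)) +
        ENNReal.ofReal L₁ *
          (⨅ (u : V3) (θ : ℝ) (_ : 0 < θ), klDiv μ (gaussMeasure u θ)) ^ (1 / 2 : ℝ) := by
  have hθx : 0 < θ₀ x := hθm.trans_le (hθ₀ x).1
  have hθM : 0 < θM := hθx.trans_le (hθ₀ x).2
  have hKpos : 0 < K₁ + 16 * C * θM + 1 := by positivity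
  by_cases hex : ∃ (u : V3) (θ : ℝ), 0 < θ ∧ klDiv μ (gaussMeasure u θ) ≠ ⊤
  swap
  · push Not at hex
    rw [hex (u₀ x) (θ₀ x) hθx, ENNReal.mul_top (ENNReal.ofReal_pos.2 hKpos).ne', top_add]
    exact le_top
  obtain ⟨u, θ, hθ, hfin⟩ := hex
  obtain ⟨m, hm⟩ : ∃ m : V3, m = ∫ v, v ∂μ := ⟨_, rfl⟩
  obtain ⟨e, he⟩ : ∃ e : ℝ, e = 1 / 3 * ∫ v, ‖v - m‖ ^ 2 ∂μ := ⟨_, rfl⟩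
  obtain ⟨h2, he0, hE, hpy⟩ := stub_oneBodyLedger_of_static_pythagoras μ u θ hθ hfin m e hm he
  have hHle : ∀ (u' : V3) (θ' : ℝ), 0 < θ' →
      klDiv μ (gaussMeasure m e) ≤ klDiv μ (gaussMeasure u' θ') := fun u' θ' hθ' => by
    rw [hpy u' θ' hθ']; exact le_self_add
  have hHfin : klDiv μ (gaussMeasure m e) ≠ ⊤ := ne_top_of_le_ne_top hfin (hHle u θ hθ)
  have hinf : klDiv μ (gaussMeasure m e) ≤
      ⨅ (u' : V3) (θ' : ℝ) (_ : 0 < θ'), klDiv μ (gaussMeasure u' θ') :=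
    le_iInf fun u' => le_iInf fun θ' => le_iInf fun hθ' => hHle u' θ' hθ'
  obtain ⟨Ex, hEx⟩ : ∃ Ex : ℝ,
      Ex = ‖m - u₀ x‖ ^ 2 / (2 * θ₀ x) + 3 / 2 * (e / θ₀ x - 1 - Real.log (e / θ₀ x)) := ⟨_, rfl⟩
  have hMx : klDiv μ (gaussMeasure (u₀ x) (θ₀ x)) = klDiv μ (gaussMeasure m e) + ENNReal.ofReal Ex := by
    rw [hpy (u₀ x) (θ₀ x) hθx, hEx]
  have hEx0 : 0 ≤ Ex := hEx ▸ obl_hydroEntropy_nonneg m (u₀ x) he0 hθx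
  have hFx : Continuous fun v : V3 => F (x, v) := by fun_prop
  obtain ⟨-, hFxle⟩ := obl_integrable_of_growth h2 hFx (fun v => hFC (x, v))
  rw [hE] at hFxle
  by_cases hhot : Θ < 3 * e + ‖m‖ ^ 2
  · -- hot fibre: paid by the hydrodynamic entropy
    have hhotb := obl_hot (m := m) hC hθm (hθ₀ x).1 (hθ₀ x).2 (hu₀ x) hΘ he0 hhot
    rw [← hEx] at hhotb
    have hKE : 0 ≤ (K₁ + 1) * Ex := by positivity
    calc ENNReal.ofReal |∫ v, F (x, v) ∂μ|
        ≤ ENNReal.ofReal ((K₁ + 16 * C * θM + 1) * Ex) :=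
          ENNReal.ofReal_le_ofReal (hFxle.trans (hhotb.trans (by nlinarith)))
      _ = ENNReal.ofReal (K₁ + 16 * C * θM + 1) * ENNReal.ofReal Ex := ENNReal.ofReal_mul hKpos.le
      _ ≤ ENNReal.ofReal (K₁ + 16 * C * θM + 1) * klDiv μ (gaussMeasure (u₀ x) (θ₀ x)) := by
          rw [hMx]; gcongr; exact le_add_self
      _ ≤ _ := le_self_add
  · -- cold fibre: static domination at the moment-matched Maxwellian plus the kinetic bound
    push Not at hhot
    have heΘ : e ≤ Θ := by nlinarith [sq_nonneg ‖m‖]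
    have hmΘ : ‖m‖ ^ 2 ≤ Θ := by nlinarith
    have hSΘ : ∫ v, ‖v‖ ^ 2 ∂μ ≤ Θ := hE ▸ hhot
    have hk := hkin (fun v => F (x, v)) hFx (fun v => hFC (x, v)) m e he0 heΘ hmΘ μ h2 hSΘ hHfin
    have hs1 : |∫ v, F (x, v) ∂gaussMeasure m e| ≤ K₁ * Ex := by
      rw [← obl_integral_mul_localMaxwellian (fun v => F (x, v)) m he0, hEx]
      exact hdom x m e he0
    have habs : |∫ v, F (x, v) ∂μ| ≤ K₁ * Ex + L₁ * Real.sqrt (klDiv μ (gaussMeasure m e)).toReal := by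
      have := abs_sub_abs_le_abs_sub (∫ v, F (x, v) ∂μ) (∫ v, F (x, v) ∂gaussMeasure m e)
      linarith
    have hsqrt : ENNReal.ofReal (Real.sqrt (klDiv μ (gaussMeasure m e)).toReal) =
        klDiv μ (gaussMeasure m e) ^ (1 / 2 : ℝ) := by
      rw [Real.sqrt_eq_rpow, ← ENNReal.ofReal_rpow_of_nonneg ENNReal.toReal_nonneg (by norm_num),
        ENNReal.ofReal_toReal hHfin]
    calc ENNReal.ofReal |∫ v, F (x, v) ∂μ|
        ≤ ENNReal.ofReal (K₁ * Ex + L₁ * Real.sqrt (klDiv μ (gaussMeasure m e)).toReal) :=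
          ENNReal.ofReal_le_ofReal habs
      _ = ENNReal.ofReal K₁ * ENNReal.ofReal Ex +
            ENNReal.ofReal L₁ * klDiv μ (gaussMeasure m e) ^ (1 / 2 : ℝ) := by
          rw [ENNReal.ofReal_add (mul_nonneg hK₁ hEx0) (mul_nonneg hL₁ (Real.sqrt_nonneg _)),
            ENNReal.ofReal_mul hK₁, ENNReal.ofReal_mul hL₁, hsqrt]
      _ ≤ _ := by
          refine add_le_add (mul_le_mul' (ENNReal.ofReal_le_ofReal (by nlinarith)) ?_)
            (mul_le_mul_right (ENNReal.rpow_le_rpow hinf (by norm_num)) _)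
          rw [hMx]
          exact le_add_self

/-- S2 — THE ONE-BODY ENTROPY LEDGER FROM STATIC DOMINATION (static, L). Given S1, for the same data there
are `K, L > 0` such that for EVERY probability law `f` on `𝕋³ × ℝ³` (fibres `f(·|x) = f.condKernel x`,
density marginal `f.fst`):
`|∫ F df| ≤ K · ∫ KL(f(·|x) ‖ N(u₀(x),θ₀(x)I)) f.fst(dx) + L · ∫ (inf_{u,θ>0} KL(f(·|x) ‖ N(u,θI)))^{1/2} f.fst(dx)`
(in `ℝ≥0∞`; trivial where the fibre entropy is infinite or `F ∉ L¹(f)`). Proof: disintegration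
`f = f.fst ⊗ f.condKernel` (`∫ F df = ∫∫ F(x,v) f(dv|x) f.fst(dx)` when `F ∈ L¹(f)`, else `∫ F df = 0`),
`‖∫ φ‖ₑ ≤ ∫⁻ ‖φ‖ₑ`, the fibrewise ledger `obl_fibre` (Gaussian Pythagoras at the moment-matched
Maxwellian, hot fibres paid by the hydrodynamic entropy, cold fibres by S1 plus the Donsker–Varadhan
kinetic bound `stub_oneBodyLedger_of_static_kinetic`), and measurability of the fibre entropy
`x ↦ KL(f.condKernel x ‖ M_x)` (`obl_measurable_klDiv`) to split the integral; the constants come from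
compactness of `𝕋³` (`θ_m ≤ θ₀ ≤ θ_M`, `‖u₀‖ ≤ U`, `Θ = 4U² + 12θ_M + 1`, `K = K_S1 + 16Cθ_M + 1`). -/
theorem stub_oneBodyLedger_of_static :
    (∀ (θ₀ : T3 → ℝ) (u₀ : T3 → V3), Continuous θ₀ → Continuous u₀ → (∀ x, 0 < θ₀ x) →
      ∀ (F : T3 × V3 → ℝ), Continuous F → ∀ C : ℝ, (∀ y, |F y| ≤ C * (1 + ‖y.2‖ ^ 2)) →
      (∀ x, ∫ v, F (x, v) * localMaxwellian 1 (θ₀ x) (u₀ x) v = 0) →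
      (∀ x (j : Fin 3), ∫ v, F (x, v) * v j * localMaxwellian 1 (θ₀ x) (u₀ x) v = 0) →
      (∀ x, ∫ v, F (x, v) * ‖v‖ ^ 2 * localMaxwellian 1 (θ₀ x) (u₀ x) v = 0) →
      ∃ K : ℝ, 0 ≤ K ∧ ∀ (x : T3) (u : V3) (θ : ℝ), 0 < θ →
        |∫ v, F (x, v) * localMaxwellian 1 θ u v| ≤
          K * (‖u - u₀ x‖ ^ 2 / (2 * θ₀ x) + 3 / 2 * (θ / θ₀ x - 1 - Real.log (θ / θ₀ x)))) →
    ∀ (θ₀ : T3 → ℝ) (u₀ : T3 → V3), Continuous θ₀ → Continuous u₀ → (∀ x, 0 < θ₀ x) →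
      ∀ (F : T3 × V3 → ℝ), Continuous F → ∀ C : ℝ, (∀ y, |F y| ≤ C * (1 + ‖y.2‖ ^ 2)) →
      (∀ x, ∫ v, F (x, v) * localMaxwellian 1 (θ₀ x) (u₀ x) v = 0) →
      (∀ x (j : Fin 3), ∫ v, F (x, v) * v j * localMaxwellian 1 (θ₀ x) (u₀ x) v = 0) →
      (∀ x, ∫ v, F (x, v) * ‖v‖ ^ 2 * localMaxwellian 1 (θ₀ x) (u₀ x) v = 0) →
      ∃ K : ℝ, 0 < K ∧ ∃ L : ℝ, 0 < L ∧ ∀ (f : Measure (T3 × V3)) [IsProbabilityMeasure f],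
        ENNReal.ofReal |∫ y, F y ∂f| ≤
          ENNReal.ofReal K * ∫⁻ x, klDiv (f.condKernel x) (gaussMeasure (u₀ x) (θ₀ x)) ∂f.fst +
          ENNReal.ofReal L *
            ∫⁻ x, (⨅ (u : V3) (θ : ℝ) (_ : 0 < θ), klDiv (f.condKernel x) (gaussMeasure u θ)) ^ (1 / 2 : ℝ)
              ∂f.fst := by
  intro hS1 θ₀ u₀ hθc huc hθpos F hF C hFC h1 h2 h3
  obtain ⟨K₁, hK₁, hdom⟩ := hS1 θ₀ u₀ hθc huc hθpos F hF C hFC h1 h2 h3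
  -- constants from the compactness of the torus
  obtain ⟨xm, -, hxm⟩ := isCompact_univ.exists_isMinOn univ_nonempty hθc.continuousOn
  obtain ⟨xM, -, hxM⟩ := isCompact_univ.exists_isMaxOn univ_nonempty hθc.continuousOn
  obtain ⟨xU, -, hxU⟩ := isCompact_univ.exists_isMaxOn univ_nonempty huc.norm.continuousOn
  have hθ₀ : ∀ x, θ₀ xm ≤ θ₀ x ∧ θ₀ x ≤ θ₀ xM := fun x => ⟨hxm (mem_univ x), hxM (mem_univ x)⟩
  have hu₀ : ∀ x, ‖u₀ x‖ ≤ ‖u₀ xU‖ := fun x => hxU (mem_univ x)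
  have hC : 0 ≤ C := by
    have := (abs_nonneg _).trans (hFC ((0 : T3), (0 : V3)))
    simpa using this
  obtain ⟨Θ, hΘ⟩ : ∃ Θ : ℝ, Θ = 4 * ‖u₀ xU‖ ^ 2 + 12 * θ₀ xM + 1 := ⟨_, rfl⟩
  have hΘ1 : 1 ≤ Θ := by rw [hΘ]; nlinarith [hθpos xM, sq_nonneg ‖u₀ xU‖]
  obtain ⟨L₁, hL₁, hkin⟩ := stub_oneBodyLedger_of_static_kinetic C Θ hC hΘ1
  have hθMpos : 0 < θ₀ xM := hθpos xM
  refine ⟨K₁ + 16 * C * θ₀ xM + 1, by positivity, L₁, hL₁, fun f _ => ?_⟩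
  -- reduction to the fibres
  have hstep : ENNReal.ofReal |∫ y, F y ∂f| ≤
      ∫⁻ x, ENNReal.ofReal |∫ v, F (x, v) ∂(f.condKernel x)| ∂f.fst := by
    by_cases hint : Integrable F f
    · rw [← Measure.integral_condKernel hint, ← Real.enorm_eq_ofReal_abs]
      refine (enorm_integral_le_lintegral_enorm _).trans_eq ?_
      simp_rw [Real.enorm_eq_ofReal_abs]
    · rw [integral_undef hint, abs_zero, ENNReal.ofReal_zero]
      exact zero_le
  have hfib : ∀ x, ENNReal.ofReal |∫ v, F (x, v) ∂(f.condKernel x)| ≤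
      ENNReal.ofReal (K₁ + 16 * C * θ₀ xM + 1) *
          klDiv (f.condKernel x) (gaussMeasure (u₀ x) (θ₀ x)) +
        ENNReal.ofReal L₁ * (⨅ (u : V3) (θ : ℝ) (_ : 0 < θ),
          klDiv (f.condKernel x) (gaussMeasure u θ)) ^ (1 / 2 : ℝ) := fun x =>
    obl_fibre hF hFC hC (hθpos xm) hθ₀ hu₀ hΘ hK₁ hL₁.le hdom hkin x (f.condKernel x)
  have hmeas : Measurable fun x => ENNReal.ofReal (K₁ + 16 * C * θ₀ xM + 1) *
      klDiv (f.condKernel x) (gaussMeasure (u₀ x) (θ₀ x)) :=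
    (obl_measurable_klDiv_gauss hθc.measurable huc.measurable f.condKernel).const_mul _
  refine hstep.trans ((lintegral_mono hfib).trans_eq ?_)
  rw [lintegral_add_left hmeas, lintegral_const_mul' _ _ ENNReal.ofReal_ne_top,
    lintegral_const_mul' _ _ ENNReal.ofReal_ne_top]

end Summit.AtomisticToContinuum.HydrodynamicLimit.Theorems.KineticCurrentsWindowLDUniformLocalGibbs

end
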